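import Summits.QuantumFields.BalabanUV.Beta.FP.RoadWardExplicit
import Summits.QuantumFields.BalabanUV.Beta.FP.StepLawWardPerf
import Summits.QuantumFields.BalabanUV.Beta.FP.PerfectWardLetters

/-!
# `BalabanUV.Beta.FP.RoadWardLetters` — road «FP» for binder row D1, «STEP-NO-HW» part (c): THE ROAD's END FOR THE PINNED FAMILY WITH **NO FINITE-`j`
# SYMMETRY ROW OF THE WALL FAMILY** — an1's hW ROW replaced by the socket `hWperf` (§2) and `hWperf` discharged from an1's FOUR COARSE LETTERS at the pinned
# perfect triple (§1, §3): residual = {pins + rebase equations, four coarse letters, hSDF (explicit), hasym} (`d = 3`, `Lc ≥ 2`, `r ∈ box (3+1) Lc`)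

HONEST DEPENDENCY (page 1, mandatory): continuum YM on T⁴ ⇐ BetaPertH ∧ nine spine estimates (0/9 proved); BetaPertH ⇐ (D1) ∧ (D4) ∧
CAP+tail; G-an2-4 gates asym, D1 and NE2/3/4.  HONEST FRAMING (cell contract, verbatim): «discharging `BetaPertH` makes Bałaban's UV
stability UNCONDITIONAL — a real constructive-QFT result; it is NOT the continuum limit and NOT the Clay problem.»  THIS MODULE DISCHARGES
NOTHING of D1 / BetaPertH: [our object] composition BY NAME over the road FP owner's `RoadWardExplicit` (p222952: `hTsymm_pinned`, `hWt_pinned`, the pinned-family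
bookkeeping), part (b) `StepLawWardPerf` and part (a) `PerfectWardLetters`, with the slot rows (`hS_hSall_three`, `hW_hWall_three_an1_pinned`), the limit classes
(`RoadFromSlots.exists_limit_rows_of_slots`), the K-side (`SymmetryKHolds.kernelSide_KPerf_one_holds`), (St)∕(Wt) of the perfect jets (`PerfectJetsTranslate`), the rebase
classes (`RoadRebasedHolds`), the explicit defect (`RoadExplicitDefect`, `StepDefectInherit.fubini_defect`) ALL SUPPLIED BY NAME.  No `def`, no `Prop` mirror, no cited
fact, 0 sorry; the four letters, `hSDF`, `hasym` are DISPLAYED hypotheses, none instantiated at a value; 0∕4 binders of row D1 discharged; NOT D1, NOT BetaPertH, NOT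
continuum, NOT Clay.

ABSOLUTE RULE (cell charter, verbatim): «No internally-minted statement may enter as a cited fact. Every hypothesis is either
kernel-proved in this package or a verbatim quotation of a PUBLISHED theorem with page reference. The manuscript(s) under audit are NOT
citable for their own disputed steps — they are the thing under adjudication; programme-internal (2001/route/tribunal) claims are never
citable.»

CONTEXT (owner ruling R-FP-13, 15:49Z): road FP's END of record is now the dressing-agnostic `StepLawWardGeneric.d1Drift_of_generic_ward_symm_explicitDefect` with
the socket `hWf`; the comb-pinned END p222952 stays as the fully instantiated WORKED INSTANCE for the v2.21 literal.  THIS FILE is that worked instance with an1's hW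
ROW replaced by the socket (§2) and by the four COARSE LETTERS for the comb-dressed leg (§3; the generic-shape supplier is leaf-01-g6's `LetterInheritanceEnd` p224402,
the comb identification is part (a) `PerfectWardLetters` p224576).  For the comb literal no finite-`j` letter supplier exists in the tree (R-FP-13 (e)): §3 is the
exact reduction the comb literal would need, nothing more.
ANSWER TO THE OWNER's QUESTION «STEP-NO-HW?» (road FP owner d1-p3-g2, journal 2026-08-20T15:20:14Z; leaf-01-g5's short route 15:22:21Z): YES — after p222952 the
END consumed an1's finite-`j` Ward row `hWj` only through `WardTransversal (flipK (TPerf 1))`; that statement IS an1's packed `hW` END at `K := Π K∞ Π` (part (a):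
`TPerfOf = hessKer (Π K Π) (vertexOfK (Π K Π) n S) W` definitionally), so it follows from the four COARSE LETTERS at the perfect triple, and every class ∕ covariance
input at the pinned triple is a tree theorem.  CONTENT:
* §1 **`hWperf_pinned_of_letters`** — the socket at the pinned triple from the letters;
* §2 **`d1Drift_JsBalT2Of_pinned_wardPerf_explicitDefect`** ∕ `endpointExistence_JsBalT2Of_pinned_wardPerf_explicitDefect` — the owner's END with `hWj` ↦ `hWperf`;
* §3 **`d1Drift_JsBalT2Of_pinned_letters_explicitDefect`** ∕ `endpointExistence_JsBalT2Of_pinned_letters_explicitDefect` — the END FROM LETTERS.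
RESULT: `D1Drift Lc (JsBalT2Of …) N μ ν` ⟸ EXACTLY {pins + rebase equations, (K)(H)(S)(W) at the pinned perfect triple (+ `X`, `X₂`, `Nr` data), `hSDF`, `hasym`} — no
ROW of the wall family (hR: R-FP-9; hW: here).  The letters are the target of leaf-01's `FP/LetterInheritance` ∕ `FP/LetterScaling` instantiation from the finite-`j′`
letters of the literal of record (owner ∕ leaf-01 lineage; (H) passes to entrywise limits trivially); the dressing question (comb `Π` here vs the Bm-rooted finite-`j`
letters — leaf-01-g5's NOTE «N3-FINE-DRESSING-MISMATCH») is the owner's ∕ (R45)'s and is NOT touched.  Unit `b2b-balaban-beta-d1-formalise-leaf-02` (gen 5).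
-/

namespace Summit.QuantumFields.BalabanUV.Beta.FP.RoadWardLetters

open Filter Topology
open scoped BigOperators
open Literature.MathematicalPhysics.QuantumFieldTheory
open Literature.MathematicalPhysics.QuantumFieldTheory.Balaban1983to89
open Literature.MathematicalPhysics.QuantumFieldTheory.Balaban1983to89.Beta
open B12Beta (secondMoment)
open B12Normalization (stepBal)
open B6BondElimination (unitVec)
open AffineAveraging (box toSite)
open DecimatedMomentSummable (AbsMoment₂)
open DressedMomentNormalisation (EKer dressedEntry)
open ExpKernelCalculus (MKer Decays VertexFamily₂ shiftK comp tadpole)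
open PolarizationSign (WardTransversal)
open KernelWard (divV divW)
open OneStepResolventKernel (Fib LocStencil)
open OneStepKernelFamily (KInvStep TbalOf flipK D1Drift colH)
open AxialDressing (axDressK axVertexOfK)
open BalabanStepJetsSucc (JsBal0Of JsBalOf)
open BalabanStepW2 (WbalOf T2Of T2Of_loc CwOf δwOf δwOf_pos WbalOf_loc₂ JsBalT2Of)
open AveragingMixedJetTables (vh₂S mixFFAt)
open FlowStep FlowStepRuns DagBinding
open RemainderChain (RemainderConst)
open Summit.QuantumFields.BalabanUV.Beta.TameKernelCalculus
open Summit.QuantumFields.BalabanUV.Beta.ChartConjugation (conjV conjW)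
open Summit.QuantumFields.BalabanUV.Beta.ChartConjugationRelative (RelInv)
open Summit.QuantumFields.BalabanUV.Beta.KernelWardRelative (gaugeWt)
open Summit.QuantumFields.BalabanUV.Beta.MixedJetTablesPlug (hmix_an1)
open Summit.QuantumFields.BalabanUV.Beta.GAN24.CombesThomas (sfStep smStep)
open Summit.QuantumFields.BalabanUV.Beta.GAN24.StencilSlotOfE3 (one_le_of_two_le)
open Summit.QuantumFields.BalabanUV.Beta.GAN24.StencilSlotSAllThree (hS_hSall_three)
open Summit.QuantumFields.BalabanUV.Beta.GAN24.WSlotT2Tables (hB_base hW_hWall_three_an1_pinned)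
open Summit.QuantumFields.BalabanUV.Beta.FP.RebaseJets (rebaseS rebaseW)
open Summit.QuantumFields.BalabanUV.Beta.FP.PerfectObjectsT (KPerf SPerfOf WPerfOf TPerfOf fPerf)
open Summit.QuantumFields.BalabanUV.Beta.FP.TransportInfinityM (colOf)
open Summit.QuantumFields.BalabanUV.Beta.FP.SymmetryKHolds (kernelSide_KPerf_one_holds)
open Summit.QuantumFields.BalabanUV.Beta.FP.PerfectJetsTranslate (SPerfOf_one_translate WPerfOf_one_translate)
open Summit.QuantumFields.BalabanUV.Beta.FP.RoadFromSlots (exists_limit_rows_of_slots)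
open Summit.QuantumFields.BalabanUV.Beta.FP.StepDefectInherit (defect fubini_defect)
open Summit.QuantumFields.BalabanUV.Beta.FP.RoadRebasedHolds (hSinf_of_rebase hWinf_of_rebase)
open Summit.QuantumFields.BalabanUV.Beta.FP.RoadExplicitDefect (absMoment₂_explicitDefect)
open Summit.QuantumFields.BalabanUV.Beta.FP.RoadWardExplicit (hWt_pinned hTsymm_pinned)
open Summit.QuantumFields.BalabanUV.Beta.FP.StepLawWardPerf (d1Drift_JsBalOf_of_rows_wardPerf_bounded endpointExistence_of_rows_wardPerf_bounded)
open Summit.QuantumFields.BalabanUV.Beta.FP.PerfectWardLetters (wardTransversal_flipK_TPerfOf_of_letters)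

noncomputable section

variable {Lc : ℕ} [NeZero Lc] {r : Fin (3 + 1) → ℕ} (hr : r ∈ box (3 + 1) Lc) (cE cVH cΛ cB : ℝ) (Tc : Fin 4 → Fin 4 → Fin 4 → Fin 4 → ℝ)
  (S : ℕ → ℕ → Fin (3 + 1) → (Fin (3 + 1) → ℤ) → MKer (3 + 1) (Fib 3))
  (Wt : ℕ → ℕ → Fin (3 + 1) → (Fin (3 + 1) → ℤ) → Fin (3 + 1) → (Fin (3 + 1) → ℤ) → MKer (3 + 1) (Fib 3))

/-! ## §1 The socket `hWperf` at the pinned perfect triple from an1's four coarse letters -/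

/-- **THE SOCKET `hWperf` AT THE PINNED PERFECT TRIPLE FROM an1's FOUR COARSE LETTERS** (`d = 3`, `2 ≤ Lc`, `r ∈ box (3+1) Lc`): part (a)
`PerfectWardLetters.wardTransversal_flipK_TPerfOf_of_letters` with every non-letter hypothesis a tree theorem — decay + coarse invariance of `KPerf … 1`
(`SymmetryKHolds.kernelSide_KPerf_one_holds`), the `m = 1` limit classes of the perfect stencils ∕ tables (`RoadFromSlots.exists_limit_rows_of_slots` over the S- and W-slot rows
`hS_hSall_three` ∕ `hW_hWall_three_an1_pinned`), (St) `PerfectJetsTranslate.SPerfOf_one_translate`, (Wt) `WPerfOf_one_translate` ∘ `RoadWardExplicit.hWt_pinned`.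
REMAINING (displayed): the four letters (K) `RelInv`, (H) ℋ-column law, (S) block-stencil law, (W) second-order pure-gauge law + tadpole-null `Nr`. [our object] -/
theorem hWperf_pinned_of_letters (hLc2 : 2 ≤ Lc)
    (hS1 : ∀ j, S j 1 = (JsBal0Of (one_le_of_two_le hLc2) cE cVH cΛ
      (WbalOf 3 Lc cE cVH cΛ (T2Of 3 Lc cE cVH cΛ ((Lc : ℝ) ^ (2 * (3 + 1))) cB Tc (vh₂S 3 Lc) (mixFFAt (toSite r) Lc)) (mixFFAt (toSite r) Lc))
      (CwOf (one_le_of_two_le hLc2) cE cVH cΛ (T2Of_loc (one_le_of_two_le hLc2) cE cVH cΛ ((Lc : ℝ) ^ (2 * (3 + 1))) cB Tc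
        (hB_base (one_le_of_two_le hLc2)) (hmix_an1 (one_le_of_two_le hLc2) hr)) (hmix_an1 (one_le_of_two_le hLc2) hr))
      (δwOf (one_le_of_two_le hLc2) cE cVH cΛ (T2Of_loc (one_le_of_two_le hLc2) cE cVH cΛ ((Lc : ℝ) ^ (2 * (3 + 1))) cB Tc
        (hB_base (one_le_of_two_le hLc2)) (hmix_an1 (one_le_of_two_le hLc2) hr)) (hmix_an1 (one_le_of_two_le hLc2) hr))
      (δwOf_pos (one_le_of_two_le hLc2) cE cVH cΛ (T2Of_loc (one_le_of_two_le hLc2) cE cVH cΛ ((Lc : ℝ) ^ (2 * (3 + 1))) cB Tc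
        (hB_base (one_le_of_two_le hLc2)) (hmix_an1 (one_le_of_two_le hLc2) hr)) (hmix_an1 (one_le_of_two_le hLc2) hr))
      (WbalOf_loc₂ (one_le_of_two_le hLc2) cE cVH cΛ (T2Of_loc (one_le_of_two_le hLc2) cE cVH cΛ ((Lc : ℝ) ^ (2 * (3 + 1))) cB Tc
        (hB_base (one_le_of_two_le hLc2)) (hmix_an1 (one_le_of_two_le hLc2) hr)) (hmix_an1 (one_le_of_two_le hLc2) hr)) j).S)
    (hW1 : ∀ j, Wt j 1 = WbalOf 3 Lc cE cVH cΛ (T2Of 3 Lc cE cVH cΛ ((Lc : ℝ) ^ (2 * (3 + 1))) cB Tc (vh₂S 3 Lc) (mixFFAt (toSite r) Lc))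
      (mixFFAt (toSite r) Lc) j)
    -- an1's four COARSE LETTERS at the pinned perfect triple, for the dressed leg `Π K∞ Π` (HYPOTHESES; their suppliers = LetterInheritance instantiation)
    {M E : MKer (3 + 1) (Fib 3)} (hM : Spr M) (hE : Spr E) (hR : RelInv (axDressK Lc (KPerf (d := 3) Lc (sfStep Lc) (smStep 3 Lc) 1)) M E)
    (cH : ℝ) (hH : ∀ (y : Fin (3 + 1) → ℤ) (κ' : Fin (3 + 1)) (u : Fin (3 + 1) → ℤ),
      ∑ μ, (colH (axDressK Lc (KPerf (d := 3) Lc (sfStep Lc) (smStep 3 Lc) 1)) Lc μ (y - unitVec μ) κ' u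
        - colH (axDressK Lc (KPerf (d := 3) Lc (sfStep Lc) (smStep 3 Lc) 1)) Lc μ y κ' u) = cH * gaugeWt Lc y κ' u)
    (X : (Fin (3 + 1) → ℤ) → MKer (3 + 1) (Fib 3)) (hX : ∀ y, Loc (X y)) (hEX : ∀ y, comp E (X y) = comp (X y) E)
    (X₂ Nr : (Fin (3 + 1) → ℤ) → Fin (3 + 1) → (Fin (3 + 1) → ℤ) → MKer (3 + 1) (Fib 3)) (hX₂ : ∀ y ν y', Loc (X₂ y ν y'))
    (hNr : ∀ y ν y', Loc (Nr y ν y')) (hEX₂ : ∀ y ν y', comp E (X₂ y ν y') = comp (X₂ y ν y') E)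
    (hSd : ∀ y : Fin (3 + 1) → ℤ, cH • ∑ v ∈ box (3 + 1) Lc, divV (SPerfOf (sfStep Lc) (smStep 3 Lc) S 1) ((Lc : ℤ) • y + toSite v) = conjV M (X y))
    (hWd : ∀ (y : Fin (3 + 1) → ℤ) (ν : Fin (3 + 1)) (y' : Fin (3 + 1) → ℤ),
      divW (WPerfOf (sfStep Lc) (smStep 3 Lc) Wt 1) y ν y'
        = conjW M 0 (axVertexOfK (KPerf (d := 3) Lc (sfStep Lc) (smStep 3 Lc) 1) Lc (SPerfOf (sfStep Lc) (smStep 3 Lc) S 1) ν y') (X y) 0 (X₂ y ν y') + Nr y ν y')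
    (hN0 : ∀ y ν y', tadpole (axDressK Lc (KPerf (d := 3) Lc (sfStep Lc) (smStep 3 Lc) 1)) (Nr y ν y') = 0)
    :
    WardTransversal (flipK (TPerfOf Lc (KPerf (d := 3) Lc (sfStep Lc) (smStep 3 Lc) 1) (SPerfOf (sfStep Lc) (smStep 3 Lc) S 1) (WPerfOf (sfStep Lc) (smStep 3 Lc) Wt 1))) := by
  obtain ⟨hKd, hKcov, -⟩ := kernelSide_KPerf_one_holds (Lc := Lc) hLc2
  obtain ⟨Cs, cS, θS, δS, hθS0, hθS1, hδS, hS, hSall⟩ := hS_hSall_three hLc2 cE cVH cΛ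
    (WbalOf 3 Lc cE cVH cΛ (T2Of 3 Lc cE cVH cΛ ((Lc : ℝ) ^ (2 * (3 + 1))) cB Tc (vh₂S 3 Lc) (mixFFAt (toSite r) Lc)) (mixFFAt (toSite r) Lc)) _ _
    (δwOf_pos (one_le_of_two_le hLc2) cE cVH cΛ (T2Of_loc (one_le_of_two_le hLc2) cE cVH cΛ ((Lc : ℝ) ^ (2 * (3 + 1))) cB Tc
        (hB_base (one_le_of_two_le hLc2)) (hmix_an1 (one_le_of_two_le hLc2) hr)) (hmix_an1 (one_le_of_two_le hLc2) hr))
    (WbalOf_loc₂ (one_le_of_two_le hLc2) cE cVH cΛ (T2Of_loc (one_le_of_two_le hLc2) cE cVH cΛ ((Lc : ℝ) ^ (2 * (3 + 1))) cB Tc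
        (hB_base (one_le_of_two_le hLc2)) (hmix_an1 (one_le_of_two_le hLc2) hr)) (hmix_an1 (one_le_of_two_le hLc2) hr))
  obtain ⟨Cw, cW, θW, δW, hθW0, hθW1, hδW, hW, hWall⟩ := hW_hWall_three_an1_pinned hLc2 hr cE cVH cΛ cB Tc
  obtain ⟨-, -, -, -, -, -, -, -, -, -, -, -, -, -, hSinf1, -, hWinf1, -⟩ :=
    exists_limit_rows_of_slots (one_le_of_two_le hLc2) cE cVH cΛ _ _ _ _ _ S Wt hLc2 hS1 hW1 hS hSall hW hWall hδS hδW hθS0 hθS1 hθW0 hθW1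
  exact wardTransversal_flipK_TPerfOf_of_letters (one_le_of_two_le hLc2) hKd hKcov hSinf1 hδS hWinf1 hδW
    (SPerfOf_one_translate (one_le_of_two_le hLc2) cE cVH cΛ _ _ _ _ _ (sfStep Lc) (smStep 3 Lc) S hS1)
    (WPerfOf_one_translate _ (sfStep Lc) (smStep 3 Lc) Wt (hWt_pinned cE cVH cΛ cB Tc hLc2) hW1)
    hM hE hR cH hH X hX hEX X₂ Nr hX₂ hNr hEX₂ hSd hWd hN0

/-! ## §2 Road FP's END for the pinned family with an1's hW ROW replaced by the socket `hWperf` -/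

/-- **ROAD «FP», THE END FOR THE PINNED FAMILY — hR REMOVED, DEFECT EXPLICIT, AND an1's hW ROW REPLACED BY THE SOCKET `hWperf`** (`d = 3`, `2 ≤ Lc`,
`r ∈ box (3+1) Lc`): `D1Drift Lc (JsBalT2Of …) N μ ν` ⟸ EXACTLY the `m = 1` pins + the `m ≥ 2` rebase equations (families of record), **`hWperf`** (Ward transversality
of the flipped PERFECT ONE-STEP kernel — no finite-`j` row), **`hSDF`** (explicit fixed-point defect), **`hasym`** (N7).  The owner's
`RoadWardExplicit.d1Drift_JsBalT2Of_pinned_ward_explicitDefect` VERBATIM with `hWj` ↦ `hWperf` (through `StepLawWardPerf.d1Drift_JsBalOf_of_rows_wardPerf_bounded`);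
`hTsymm` (`RoadWardExplicit.hTsymm_pinned`), slot rows, rebase classes, `hfub`∕`hDA` supplied BY NAME as there.  NOT «D1 closed». [our object] -/
theorem d1Drift_JsBalT2Of_pinned_wardPerf_explicitDefect (hLc2 : 2 ≤ Lc)
    (hS1 : ∀ j, S j 1 = (JsBal0Of (one_le_of_two_le hLc2) cE cVH cΛ
      (WbalOf 3 Lc cE cVH cΛ (T2Of 3 Lc cE cVH cΛ ((Lc : ℝ) ^ (2 * (3 + 1))) cB Tc (vh₂S 3 Lc) (mixFFAt (toSite r) Lc)) (mixFFAt (toSite r) Lc))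
      (CwOf (one_le_of_two_le hLc2) cE cVH cΛ (T2Of_loc (one_le_of_two_le hLc2) cE cVH cΛ ((Lc : ℝ) ^ (2 * (3 + 1))) cB Tc
        (hB_base (one_le_of_two_le hLc2)) (hmix_an1 (one_le_of_two_le hLc2) hr)) (hmix_an1 (one_le_of_two_le hLc2) hr))
      (δwOf (one_le_of_two_le hLc2) cE cVH cΛ (T2Of_loc (one_le_of_two_le hLc2) cE cVH cΛ ((Lc : ℝ) ^ (2 * (3 + 1))) cB Tc
        (hB_base (one_le_of_two_le hLc2)) (hmix_an1 (one_le_of_two_le hLc2) hr)) (hmix_an1 (one_le_of_two_le hLc2) hr))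
      (δwOf_pos (one_le_of_two_le hLc2) cE cVH cΛ (T2Of_loc (one_le_of_two_le hLc2) cE cVH cΛ ((Lc : ℝ) ^ (2 * (3 + 1))) cB Tc
        (hB_base (one_le_of_two_le hLc2)) (hmix_an1 (one_le_of_two_le hLc2) hr)) (hmix_an1 (one_le_of_two_le hLc2) hr))
      (WbalOf_loc₂ (one_le_of_two_le hLc2) cE cVH cΛ (T2Of_loc (one_le_of_two_le hLc2) cE cVH cΛ ((Lc : ℝ) ^ (2 * (3 + 1))) cB Tc
        (hB_base (one_le_of_two_le hLc2)) (hmix_an1 (one_le_of_two_le hLc2) hr)) (hmix_an1 (one_le_of_two_le hLc2) hr)) j).S)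
    (hW1 : ∀ j, Wt j 1 = WbalOf 3 Lc cE cVH cΛ (T2Of 3 Lc cE cVH cΛ ((Lc : ℝ) ^ (2 * (3 + 1))) cB Tc (vh₂S 3 Lc) (mixFFAt (toSite r) Lc))
      (mixFFAt (toSite r) Lc) j)
    (hSm : ∀ m : ℕ, 2 ≤ m → ∃ (W : ℕ → Fin (3 + 1) → (Fin (3 + 1) → ℤ) → Fin (3 + 1) → (Fin (3 + 1) → ℤ) → MKer (3 + 1) (Fib 3))
      (Cw δw : ℕ → ℝ) (hδw : ∀ j, 0 < δw j) (hW' : ∀ j, VertexFamily₂ (W j) (Lc ^ m) (Cw j) (δw j)) (h1 : 1 ≤ Lc ^ m),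
      ∀ j, S j m = rebaseS Lc m (fun j' => (JsBal0Of h1 cE cVH cΛ W Cw δw hδw hW' j').S) j)
    (hWm : ∀ m : ℕ, 2 ≤ m → ∀ j, Wt j m = rebaseW Lc m (WbalOf 3 (Lc ^ m) cE cVH cΛ
      (T2Of 3 (Lc ^ m) cE cVH cΛ (((Lc ^ m : ℕ) : ℝ) ^ (2 * (3 + 1))) cB Tc (vh₂S 3 (Lc ^ m)) (mixFFAt (toSite r) (Lc ^ m)))
      (mixFFAt (toSite r) (Lc ^ m))) j)
    (hWperf : WardTransversal (flipK (TPerfOf Lc (KPerf (d := 3) Lc (sfStep Lc) (smStep 3 Lc) 1) (SPerfOf (sfStep Lc) (smStep 3 Lc) S 1)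
      (WPerfOf (sfStep Lc) (smStep 3 Lc) Wt 1))))
    (μ ν : Fin 4)
    (hSDF : ∀ m : ℕ, 1 ≤ m → secondMoment (defect
      (fun m => TPerfOf (Lc ^ m) (KPerf (d := 3) Lc (sfStep Lc) (smStep 3 Lc) m) (SPerfOf (sfStep Lc) (smStep 3 Lc) S m)
        (WPerfOf (sfStep Lc) (smStep 3 Lc) Wt m))
      (fun m a b z => ((Lc ^ m : ℕ) : ℝ) ^ 8 * dressedEntry (colOf (KPerf (d := 3) Lc (sfStep Lc) (smStep 3 Lc) m))
        (TPerfOf Lc (KPerf Lc (sfStep Lc) (smStep 3 Lc) 1) (SPerfOf (sfStep Lc) (smStep 3 Lc) S 1) (WPerfOf (sfStep Lc) (smStep 3 Lc) Wt 1))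
        (((Lc ^ m : ℕ) : ℤ) • z) a b) m) μ ν = 0)
    {N Cg : ℝ} (hasym : ∀ m : ℕ, 1 ≤ m → |fPerf Lc (sfStep Lc) (smStep 3 Lc) S Wt μ ν m - (m : ℝ) * stepBal N Lc| ≤ Cg) :
    D1Drift Lc (JsBalT2Of (one_le_of_two_le hLc2) cE cVH cΛ ((Lc : ℝ) ^ (2 * (3 + 1))) cB Tc (hB_base (one_le_of_two_le hLc2))
      (hmix_an1 (one_le_of_two_le hLc2) hr)) N μ ν := by
  obtain ⟨Cs, cS, θS, δS, hθS0, hθS1, hδS, hS, hSall⟩ := hS_hSall_three hLc2 cE cVH cΛ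
    (WbalOf 3 Lc cE cVH cΛ (T2Of 3 Lc cE cVH cΛ ((Lc : ℝ) ^ (2 * (3 + 1))) cB Tc (vh₂S 3 Lc) (mixFFAt (toSite r) Lc)) (mixFFAt (toSite r) Lc)) _ _
    (δwOf_pos (one_le_of_two_le hLc2) cE cVH cΛ (T2Of_loc (one_le_of_two_le hLc2) cE cVH cΛ ((Lc : ℝ) ^ (2 * (3 + 1))) cB Tc
        (hB_base (one_le_of_two_le hLc2)) (hmix_an1 (one_le_of_two_le hLc2) hr)) (hmix_an1 (one_le_of_two_le hLc2) hr))
    (WbalOf_loc₂ (one_le_of_two_le hLc2) cE cVH cΛ (T2Of_loc (one_le_of_two_le hLc2) cE cVH cΛ ((Lc : ℝ) ^ (2 * (3 + 1))) cB Tc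
        (hB_base (one_le_of_two_le hLc2)) (hmix_an1 (one_le_of_two_le hLc2) hr)) (hmix_an1 (one_le_of_two_le hLc2) hr))
  obtain ⟨Cw, cW, θW, δW, hθW0, hθW1, hδW, hW, hWall⟩ := hW_hWall_three_an1_pinned hLc2 hr cE cVH cΛ cB Tc
  exact d1Drift_JsBalOf_of_rows_wardPerf_bounded (one_le_of_two_le hLc2) cE cVH cΛ _ _ _ _ _ S Wt hLc2 hS1 hW1 hS hSall hW hWall hδS hδW hθS0 hθS1
    hθW0 hθW1 hWperf (hTsymm_pinned hr cE cVH cΛ cB Tc S Wt hLc2 hS1 hW1) (hSinf_of_rebase cE cVH cΛ S hLc2 hSm)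
    (hWinf_of_rebase hr cE cVH cΛ cB Tc Wt hLc2 hWm) (absMoment₂_explicitDefect hr cE cVH cΛ cB Tc S Wt hLc2 hS1 hW1 hSm hWm)
    (fun m _ a b z => fubini_defect
      (TP := fun m => TPerfOf (Lc ^ m) (KPerf (d := 3) Lc (sfStep Lc) (smStep 3 Lc) m) (SPerfOf (sfStep Lc) (smStep 3 Lc) S m)
        (WPerfOf (sfStep Lc) (smStep 3 Lc) Wt m))
      (RP := fun m a b z => ((Lc ^ m : ℕ) : ℝ) ^ 8 * dressedEntry (colOf (KPerf (d := 3) Lc (sfStep Lc) (smStep 3 Lc) m))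
        (TPerfOf Lc (KPerf Lc (sfStep Lc) (smStep 3 Lc) 1) (SPerfOf (sfStep Lc) (smStep 3 Lc) S 1) (WPerfOf (sfStep Lc) (smStep 3 Lc) Wt 1))
        (((Lc ^ m : ℕ) : ℤ) • z) a b) m a b z)
    μ ν hSDF hasym

/-- **THE CELL's END STATEMENT FROM ROAD «FP» FOR THE PINNED FAMILY — hR REMOVED, DEFECT EXPLICIT, hW ROW ↦ `hWperf`**: `EndpointExistence Cn` BY TYPE from
the pins + rebase equations, `hWperf`, `hSDF` (explicit defect), bounded-defect asymptotics, `hβ`, (D4) `RemainderConst` with `rr ≤ stepBal`, (C), `hgen`.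
NOT the continuum limit's construction. [our object] -/
theorem endpointExistence_JsBalT2Of_pinned_wardPerf_explicitDefect (hLc2 : 2 ≤ Lc)
    (hS1 : ∀ j, S j 1 = (JsBal0Of (one_le_of_two_le hLc2) cE cVH cΛ
      (WbalOf 3 Lc cE cVH cΛ (T2Of 3 Lc cE cVH cΛ ((Lc : ℝ) ^ (2 * (3 + 1))) cB Tc (vh₂S 3 Lc) (mixFFAt (toSite r) Lc)) (mixFFAt (toSite r) Lc))
      (CwOf (one_le_of_two_le hLc2) cE cVH cΛ (T2Of_loc (one_le_of_two_le hLc2) cE cVH cΛ ((Lc : ℝ) ^ (2 * (3 + 1))) cB Tc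
        (hB_base (one_le_of_two_le hLc2)) (hmix_an1 (one_le_of_two_le hLc2) hr)) (hmix_an1 (one_le_of_two_le hLc2) hr))
      (δwOf (one_le_of_two_le hLc2) cE cVH cΛ (T2Of_loc (one_le_of_two_le hLc2) cE cVH cΛ ((Lc : ℝ) ^ (2 * (3 + 1))) cB Tc
        (hB_base (one_le_of_two_le hLc2)) (hmix_an1 (one_le_of_two_le hLc2) hr)) (hmix_an1 (one_le_of_two_le hLc2) hr))
      (δwOf_pos (one_le_of_two_le hLc2) cE cVH cΛ (T2Of_loc (one_le_of_two_le hLc2) cE cVH cΛ ((Lc : ℝ) ^ (2 * (3 + 1))) cB Tc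
        (hB_base (one_le_of_two_le hLc2)) (hmix_an1 (one_le_of_two_le hLc2) hr)) (hmix_an1 (one_le_of_two_le hLc2) hr))
      (WbalOf_loc₂ (one_le_of_two_le hLc2) cE cVH cΛ (T2Of_loc (one_le_of_two_le hLc2) cE cVH cΛ ((Lc : ℝ) ^ (2 * (3 + 1))) cB Tc
        (hB_base (one_le_of_two_le hLc2)) (hmix_an1 (one_le_of_two_le hLc2) hr)) (hmix_an1 (one_le_of_two_le hLc2) hr)) j).S)
    (hW1 : ∀ j, Wt j 1 = WbalOf 3 Lc cE cVH cΛ (T2Of 3 Lc cE cVH cΛ ((Lc : ℝ) ^ (2 * (3 + 1))) cB Tc (vh₂S 3 Lc) (mixFFAt (toSite r) Lc))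
      (mixFFAt (toSite r) Lc) j)
    (hSm : ∀ m : ℕ, 2 ≤ m → ∃ (W : ℕ → Fin (3 + 1) → (Fin (3 + 1) → ℤ) → Fin (3 + 1) → (Fin (3 + 1) → ℤ) → MKer (3 + 1) (Fib 3))
      (Cw δw : ℕ → ℝ) (hδw : ∀ j, 0 < δw j) (hW' : ∀ j, VertexFamily₂ (W j) (Lc ^ m) (Cw j) (δw j)) (h1 : 1 ≤ Lc ^ m),
      ∀ j, S j m = rebaseS Lc m (fun j' => (JsBal0Of h1 cE cVH cΛ W Cw δw hδw hW' j').S) j)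
    (hWm : ∀ m : ℕ, 2 ≤ m → ∀ j, Wt j m = rebaseW Lc m (WbalOf 3 (Lc ^ m) cE cVH cΛ
      (T2Of 3 (Lc ^ m) cE cVH cΛ (((Lc ^ m : ℕ) : ℝ) ^ (2 * (3 + 1))) cB Tc (vh₂S 3 (Lc ^ m)) (mixFFAt (toSite r) (Lc ^ m)))
      (mixFFAt (toSite r) (Lc ^ m))) j)
    (hWperf : WardTransversal (flipK (TPerfOf Lc (KPerf (d := 3) Lc (sfStep Lc) (smStep 3 Lc) 1) (SPerfOf (sfStep Lc) (smStep 3 Lc) S 1)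
      (WPerfOf (sfStep Lc) (smStep 3 Lc) Wt 1))))
    (μ ν : Fin 4)
    (hSDF : ∀ m : ℕ, 1 ≤ m → secondMoment (defect
      (fun m => TPerfOf (Lc ^ m) (KPerf (d := 3) Lc (sfStep Lc) (smStep 3 Lc) m) (SPerfOf (sfStep Lc) (smStep 3 Lc) S m)
        (WPerfOf (sfStep Lc) (smStep 3 Lc) Wt m))
      (fun m a b z => ((Lc ^ m : ℕ) : ℝ) ^ 8 * dressedEntry (colOf (KPerf (d := 3) Lc (sfStep Lc) (smStep 3 Lc) m))
        (TPerfOf Lc (KPerf Lc (sfStep Lc) (smStep 3 Lc) 1) (SPerfOf (sfStep Lc) (smStep 3 Lc) S 1) (WPerfOf (sfStep Lc) (smStep 3 Lc) Wt 1))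
        (((Lc ^ m : ℕ) : ℤ) • z) a b) m) μ ν = 0)
    {N Cg : ℝ} (hasym : ∀ m : ℕ, 1 ≤ m → |fPerf Lc (sfStep Lc) (smStep 3 Lc) S Wt μ ν m - (m : ℝ) * stepBal N Lc| ≤ Cg)
    {β : HBeta} {Cn : B12.Construction} (hgen : ForwardGenerated Cn β) (Sβ : B12Beta.OneLoopSplit β)
    (hβ : ∀ j, Sβ.β0 j = B12Beta.secondMoment (TbalOf Lc (JsBalT2Of (one_le_of_two_le hLc2) cE cVH cΛ ((Lc : ℝ) ^ (2 * (3 + 1))) cB Tc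
      (hB_base (one_le_of_two_le hLc2)) (hmix_an1 (one_le_of_two_le hLc2) hr)) j) μ ν)
    {rr γ₀ : ℝ} (hγ₀ : 0 < γ₀) (hrem : RemainderConst Sβ γ₀ rr) (hr' : rr ≤ stepBal N Lc) (hcont : BetaContH γ₀ β) :
    EndpointExistence Cn := by
  obtain ⟨Cs, cS, θS, δS, hθS0, hθS1, hδS, hS, hSall⟩ := hS_hSall_three hLc2 cE cVH cΛ
    (WbalOf 3 Lc cE cVH cΛ (T2Of 3 Lc cE cVH cΛ ((Lc : ℝ) ^ (2 * (3 + 1))) cB Tc (vh₂S 3 Lc) (mixFFAt (toSite r) Lc)) (mixFFAt (toSite r) Lc)) _ _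
    (δwOf_pos (one_le_of_two_le hLc2) cE cVH cΛ (T2Of_loc (one_le_of_two_le hLc2) cE cVH cΛ ((Lc : ℝ) ^ (2 * (3 + 1))) cB Tc
        (hB_base (one_le_of_two_le hLc2)) (hmix_an1 (one_le_of_two_le hLc2) hr)) (hmix_an1 (one_le_of_two_le hLc2) hr))
    (WbalOf_loc₂ (one_le_of_two_le hLc2) cE cVH cΛ (T2Of_loc (one_le_of_two_le hLc2) cE cVH cΛ ((Lc : ℝ) ^ (2 * (3 + 1))) cB Tc
        (hB_base (one_le_of_two_le hLc2)) (hmix_an1 (one_le_of_two_le hLc2) hr)) (hmix_an1 (one_le_of_two_le hLc2) hr))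
  obtain ⟨Cw, cW, θW, δW, hθW0, hθW1, hδW, hW, hWall⟩ := hW_hWall_three_an1_pinned hLc2 hr cE cVH cΛ cB Tc
  exact endpointExistence_of_rows_wardPerf_bounded (one_le_of_two_le hLc2) cE cVH cΛ _ _ _ _ _ S Wt hLc2 hS1 hW1 hS hSall hW hWall hδS hδW hθS0 hθS1
    hθW0 hθW1 hWperf (hTsymm_pinned hr cE cVH cΛ cB Tc S Wt hLc2 hS1 hW1) (hSinf_of_rebase cE cVH cΛ S hLc2 hSm)
    (hWinf_of_rebase hr cE cVH cΛ cB Tc Wt hLc2 hWm) (absMoment₂_explicitDefect hr cE cVH cΛ cB Tc S Wt hLc2 hS1 hW1 hSm hWm)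
    (fun m _ a b z => fubini_defect
      (TP := fun m => TPerfOf (Lc ^ m) (KPerf (d := 3) Lc (sfStep Lc) (smStep 3 Lc) m) (SPerfOf (sfStep Lc) (smStep 3 Lc) S m)
        (WPerfOf (sfStep Lc) (smStep 3 Lc) Wt m))
      (RP := fun m a b z => ((Lc ^ m : ℕ) : ℝ) ^ 8 * dressedEntry (colOf (KPerf (d := 3) Lc (sfStep Lc) (smStep 3 Lc) m))
        (TPerfOf Lc (KPerf Lc (sfStep Lc) (smStep 3 Lc) 1) (SPerfOf (sfStep Lc) (smStep 3 Lc) S 1) (WPerfOf (sfStep Lc) (smStep 3 Lc) Wt 1))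
        (((Lc ^ m : ℕ) : ℤ) • z) a b) m a b z)
    μ ν hSDF hasym hgen Sβ hβ hγ₀ hrem hr' hcont

/-! ## §3 Road FP's END for the pinned family FROM LETTERS — no finite-`j` symmetry row of the wall family -/

/-- **ROAD «FP», THE END FOR THE PINNED FAMILY FROM LETTERS — NO FINITE-`j` SYMMETRY ROW OF THE WALL FAMILY (neither an2's hR nor an1's hW)**
(`d = 3`, `2 ≤ Lc`, `r ∈ box (3+1) Lc`): `D1Drift Lc (JsBalT2Of …) N μ ν` ⟸ EXACTLY the `m = 1` pins + the `m ≥ 2` rebase equations (families of record), an1's FOUR COARSE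
LETTERS at the pinned perfect triple for the dressed leg `Π K∞ Π` ((K) `RelInv`, (H) ℋ-column law with `c_H`, (S) block-stencil law, (W) second-order pure-gauge law, with the
generator ∕ contact ∕ tadpole-null remainder families `X`, `X₂`, `Nr`), **`hSDF`** (explicit fixed-point defect), **`hasym`** (N7) — §2 with `hWperf` DISCHARGED by §1.
NOT «D1 closed»: the letters, `hSDF`, `hasym` are HYPOTHESES. [our object] -/
theorem d1Drift_JsBalT2Of_pinned_letters_explicitDefect (hLc2 : 2 ≤ Lc)
    (hS1 : ∀ j, S j 1 = (JsBal0Of (one_le_of_two_le hLc2) cE cVH cΛ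
      (WbalOf 3 Lc cE cVH cΛ (T2Of 3 Lc cE cVH cΛ ((Lc : ℝ) ^ (2 * (3 + 1))) cB Tc (vh₂S 3 Lc) (mixFFAt (toSite r) Lc)) (mixFFAt (toSite r) Lc))
      (CwOf (one_le_of_two_le hLc2) cE cVH cΛ (T2Of_loc (one_le_of_two_le hLc2) cE cVH cΛ ((Lc : ℝ) ^ (2 * (3 + 1))) cB Tc
        (hB_base (one_le_of_two_le hLc2)) (hmix_an1 (one_le_of_two_le hLc2) hr)) (hmix_an1 (one_le_of_two_le hLc2) hr))
      (δwOf (one_le_of_two_le hLc2) cE cVH cΛ (T2Of_loc (one_le_of_two_le hLc2) cE cVH cΛ ((Lc : ℝ) ^ (2 * (3 + 1))) cB Tc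
        (hB_base (one_le_of_two_le hLc2)) (hmix_an1 (one_le_of_two_le hLc2) hr)) (hmix_an1 (one_le_of_two_le hLc2) hr))
      (δwOf_pos (one_le_of_two_le hLc2) cE cVH cΛ (T2Of_loc (one_le_of_two_le hLc2) cE cVH cΛ ((Lc : ℝ) ^ (2 * (3 + 1))) cB Tc
        (hB_base (one_le_of_two_le hLc2)) (hmix_an1 (one_le_of_two_le hLc2) hr)) (hmix_an1 (one_le_of_two_le hLc2) hr))
      (WbalOf_loc₂ (one_le_of_two_le hLc2) cE cVH cΛ (T2Of_loc (one_le_of_two_le hLc2) cE cVH cΛ ((Lc : ℝ) ^ (2 * (3 + 1))) cB Tc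
        (hB_base (one_le_of_two_le hLc2)) (hmix_an1 (one_le_of_two_le hLc2) hr)) (hmix_an1 (one_le_of_two_le hLc2) hr)) j).S)
    (hW1 : ∀ j, Wt j 1 = WbalOf 3 Lc cE cVH cΛ (T2Of 3 Lc cE cVH cΛ ((Lc : ℝ) ^ (2 * (3 + 1))) cB Tc (vh₂S 3 Lc) (mixFFAt (toSite r) Lc))
      (mixFFAt (toSite r) Lc) j)
    (hSm : ∀ m : ℕ, 2 ≤ m → ∃ (W : ℕ → Fin (3 + 1) → (Fin (3 + 1) → ℤ) → Fin (3 + 1) → (Fin (3 + 1) → ℤ) → MKer (3 + 1) (Fib 3))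
      (Cw δw : ℕ → ℝ) (hδw : ∀ j, 0 < δw j) (hW' : ∀ j, VertexFamily₂ (W j) (Lc ^ m) (Cw j) (δw j)) (h1 : 1 ≤ Lc ^ m),
      ∀ j, S j m = rebaseS Lc m (fun j' => (JsBal0Of h1 cE cVH cΛ W Cw δw hδw hW' j').S) j)
    (hWm : ∀ m : ℕ, 2 ≤ m → ∀ j, Wt j m = rebaseW Lc m (WbalOf 3 (Lc ^ m) cE cVH cΛ
      (T2Of 3 (Lc ^ m) cE cVH cΛ (((Lc ^ m : ℕ) : ℝ) ^ (2 * (3 + 1))) cB Tc (vh₂S 3 (Lc ^ m)) (mixFFAt (toSite r) (Lc ^ m)))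
      (mixFFAt (toSite r) (Lc ^ m))) j)
    -- an1's four COARSE LETTERS at the pinned perfect triple, for the dressed leg `Π K∞ Π` (HYPOTHESES; their suppliers = LetterInheritance instantiation)
    {M E : MKer (3 + 1) (Fib 3)} (hM : Spr M) (hE : Spr E) (hR : RelInv (axDressK Lc (KPerf (d := 3) Lc (sfStep Lc) (smStep 3 Lc) 1)) M E)
    (cH : ℝ) (hH : ∀ (y : Fin (3 + 1) → ℤ) (κ' : Fin (3 + 1)) (u : Fin (3 + 1) → ℤ),
      ∑ μ, (colH (axDressK Lc (KPerf (d := 3) Lc (sfStep Lc) (smStep 3 Lc) 1)) Lc μ (y - unitVec μ) κ' u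
        - colH (axDressK Lc (KPerf (d := 3) Lc (sfStep Lc) (smStep 3 Lc) 1)) Lc μ y κ' u) = cH * gaugeWt Lc y κ' u)
    (X : (Fin (3 + 1) → ℤ) → MKer (3 + 1) (Fib 3)) (hX : ∀ y, Loc (X y)) (hEX : ∀ y, comp E (X y) = comp (X y) E)
    (X₂ Nr : (Fin (3 + 1) → ℤ) → Fin (3 + 1) → (Fin (3 + 1) → ℤ) → MKer (3 + 1) (Fib 3)) (hX₂ : ∀ y ν y', Loc (X₂ y ν y'))
    (hNr : ∀ y ν y', Loc (Nr y ν y')) (hEX₂ : ∀ y ν y', comp E (X₂ y ν y') = comp (X₂ y ν y') E)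
    (hSd : ∀ y : Fin (3 + 1) → ℤ, cH • ∑ v ∈ box (3 + 1) Lc, divV (SPerfOf (sfStep Lc) (smStep 3 Lc) S 1) ((Lc : ℤ) • y + toSite v) = conjV M (X y))
    (hWd : ∀ (y : Fin (3 + 1) → ℤ) (ν : Fin (3 + 1)) (y' : Fin (3 + 1) → ℤ),
      divW (WPerfOf (sfStep Lc) (smStep 3 Lc) Wt 1) y ν y'
        = conjW M 0 (axVertexOfK (KPerf (d := 3) Lc (sfStep Lc) (smStep 3 Lc) 1) Lc (SPerfOf (sfStep Lc) (smStep 3 Lc) S 1) ν y') (X y) 0 (X₂ y ν y') + Nr y ν y')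
    (hN0 : ∀ y ν y', tadpole (axDressK Lc (KPerf (d := 3) Lc (sfStep Lc) (smStep 3 Lc) 1)) (Nr y ν y') = 0)
    (μ ν : Fin 4)
    (hSDF : ∀ m : ℕ, 1 ≤ m → secondMoment (defect
      (fun m => TPerfOf (Lc ^ m) (KPerf (d := 3) Lc (sfStep Lc) (smStep 3 Lc) m) (SPerfOf (sfStep Lc) (smStep 3 Lc) S m)
        (WPerfOf (sfStep Lc) (smStep 3 Lc) Wt m))
      (fun m a b z => ((Lc ^ m : ℕ) : ℝ) ^ 8 * dressedEntry (colOf (KPerf (d := 3) Lc (sfStep Lc) (smStep 3 Lc) m))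
        (TPerfOf Lc (KPerf Lc (sfStep Lc) (smStep 3 Lc) 1) (SPerfOf (sfStep Lc) (smStep 3 Lc) S 1) (WPerfOf (sfStep Lc) (smStep 3 Lc) Wt 1))
        (((Lc ^ m : ℕ) : ℤ) • z) a b) m) μ ν = 0)
    {N Cg : ℝ} (hasym : ∀ m : ℕ, 1 ≤ m → |fPerf Lc (sfStep Lc) (smStep 3 Lc) S Wt μ ν m - (m : ℝ) * stepBal N Lc| ≤ Cg) :
    D1Drift Lc (JsBalT2Of (one_le_of_two_le hLc2) cE cVH cΛ ((Lc : ℝ) ^ (2 * (3 + 1))) cB Tc (hB_base (one_le_of_two_le hLc2))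
      (hmix_an1 (one_le_of_two_le hLc2) hr)) N μ ν := by
  obtain ⟨Cs, cS, θS, δS, hθS0, hθS1, hδS, hS, hSall⟩ := hS_hSall_three hLc2 cE cVH cΛ
    (WbalOf 3 Lc cE cVH cΛ (T2Of 3 Lc cE cVH cΛ ((Lc : ℝ) ^ (2 * (3 + 1))) cB Tc (vh₂S 3 Lc) (mixFFAt (toSite r) Lc)) (mixFFAt (toSite r) Lc)) _ _
    (δwOf_pos (one_le_of_two_le hLc2) cE cVH cΛ (T2Of_loc (one_le_of_two_le hLc2) cE cVH cΛ ((Lc : ℝ) ^ (2 * (3 + 1))) cB Tc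
        (hB_base (one_le_of_two_le hLc2)) (hmix_an1 (one_le_of_two_le hLc2) hr)) (hmix_an1 (one_le_of_two_le hLc2) hr))
    (WbalOf_loc₂ (one_le_of_two_le hLc2) cE cVH cΛ (T2Of_loc (one_le_of_two_le hLc2) cE cVH cΛ ((Lc : ℝ) ^ (2 * (3 + 1))) cB Tc
        (hB_base (one_le_of_two_le hLc2)) (hmix_an1 (one_le_of_two_le hLc2) hr)) (hmix_an1 (one_le_of_two_le hLc2) hr))
  obtain ⟨Cw, cW, θW, δW, hθW0, hθW1, hδW, hW, hWall⟩ := hW_hWall_three_an1_pinned hLc2 hr cE cVH cΛ cB Tc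
  exact d1Drift_JsBalOf_of_rows_wardPerf_bounded (one_le_of_two_le hLc2) cE cVH cΛ _ _ _ _ _ S Wt hLc2 hS1 hW1 hS hSall hW hWall hδS hδW hθS0 hθS1
    hθW0 hθW1
    (hWperf_pinned_of_letters hr cE cVH cΛ cB Tc S Wt hLc2 hS1 hW1 hM hE hR cH hH X hX hEX X₂ Nr hX₂ hNr hEX₂ hSd hWd hN0) (hTsymm_pinned hr cE cVH cΛ cB Tc S Wt hLc2 hS1 hW1) (hSinf_of_rebase cE cVH cΛ S hLc2 hSm)
    (hWinf_of_rebase hr cE cVH cΛ cB Tc Wt hLc2 hWm) (absMoment₂_explicitDefect hr cE cVH cΛ cB Tc S Wt hLc2 hS1 hW1 hSm hWm)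
    (fun m _ a b z => fubini_defect
      (TP := fun m => TPerfOf (Lc ^ m) (KPerf (d := 3) Lc (sfStep Lc) (smStep 3 Lc) m) (SPerfOf (sfStep Lc) (smStep 3 Lc) S m)
        (WPerfOf (sfStep Lc) (smStep 3 Lc) Wt m))
      (RP := fun m a b z => ((Lc ^ m : ℕ) : ℝ) ^ 8 * dressedEntry (colOf (KPerf (d := 3) Lc (sfStep Lc) (smStep 3 Lc) m))
        (TPerfOf Lc (KPerf Lc (sfStep Lc) (smStep 3 Lc) 1) (SPerfOf (sfStep Lc) (smStep 3 Lc) S 1) (WPerfOf (sfStep Lc) (smStep 3 Lc) Wt 1))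
        (((Lc ^ m : ℕ) : ℤ) • z) a b) m a b z)
    μ ν hSDF hasym

/-- **THE CELL's END STATEMENT FROM ROAD «FP» FOR THE PINNED FAMILY FROM LETTERS**: `EndpointExistence Cn` BY TYPE from the pins + rebase equations, an1's four
coarse letters at the pinned perfect triple, `hSDF` (explicit defect), bounded-defect asymptotics, `hβ`, (D4) `RemainderConst` with `rr ≤ stepBal`, (C), `hgen`.  NOT the
continuum limit's construction. [our object] -/
theorem endpointExistence_JsBalT2Of_pinned_letters_explicitDefect (hLc2 : 2 ≤ Lc)
    (hS1 : ∀ j, S j 1 = (JsBal0Of (one_le_of_two_le hLc2) cE cVH cΛ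
      (WbalOf 3 Lc cE cVH cΛ (T2Of 3 Lc cE cVH cΛ ((Lc : ℝ) ^ (2 * (3 + 1))) cB Tc (vh₂S 3 Lc) (mixFFAt (toSite r) Lc)) (mixFFAt (toSite r) Lc))
      (CwOf (one_le_of_two_le hLc2) cE cVH cΛ (T2Of_loc (one_le_of_two_le hLc2) cE cVH cΛ ((Lc : ℝ) ^ (2 * (3 + 1))) cB Tc
        (hB_base (one_le_of_two_le hLc2)) (hmix_an1 (one_le_of_two_le hLc2) hr)) (hmix_an1 (one_le_of_two_le hLc2) hr))
      (δwOf (one_le_of_two_le hLc2) cE cVH cΛ (T2Of_loc (one_le_of_two_le hLc2) cE cVH cΛ ((Lc : ℝ) ^ (2 * (3 + 1))) cB Tc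
        (hB_base (one_le_of_two_le hLc2)) (hmix_an1 (one_le_of_two_le hLc2) hr)) (hmix_an1 (one_le_of_two_le hLc2) hr))
      (δwOf_pos (one_le_of_two_le hLc2) cE cVH cΛ (T2Of_loc (one_le_of_two_le hLc2) cE cVH cΛ ((Lc : ℝ) ^ (2 * (3 + 1))) cB Tc
        (hB_base (one_le_of_two_le hLc2)) (hmix_an1 (one_le_of_two_le hLc2) hr)) (hmix_an1 (one_le_of_two_le hLc2) hr))
      (WbalOf_loc₂ (one_le_of_two_le hLc2) cE cVH cΛ (T2Of_loc (one_le_of_two_le hLc2) cE cVH cΛ ((Lc : ℝ) ^ (2 * (3 + 1))) cB Tc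
        (hB_base (one_le_of_two_le hLc2)) (hmix_an1 (one_le_of_two_le hLc2) hr)) (hmix_an1 (one_le_of_two_le hLc2) hr)) j).S)
    (hW1 : ∀ j, Wt j 1 = WbalOf 3 Lc cE cVH cΛ (T2Of 3 Lc cE cVH cΛ ((Lc : ℝ) ^ (2 * (3 + 1))) cB Tc (vh₂S 3 Lc) (mixFFAt (toSite r) Lc))
      (mixFFAt (toSite r) Lc) j)
    (hSm : ∀ m : ℕ, 2 ≤ m → ∃ (W : ℕ → Fin (3 + 1) → (Fin (3 + 1) → ℤ) → Fin (3 + 1) → (Fin (3 + 1) → ℤ) → MKer (3 + 1) (Fib 3))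
      (Cw δw : ℕ → ℝ) (hδw : ∀ j, 0 < δw j) (hW' : ∀ j, VertexFamily₂ (W j) (Lc ^ m) (Cw j) (δw j)) (h1 : 1 ≤ Lc ^ m),
      ∀ j, S j m = rebaseS Lc m (fun j' => (JsBal0Of h1 cE cVH cΛ W Cw δw hδw hW' j').S) j)
    (hWm : ∀ m : ℕ, 2 ≤ m → ∀ j, Wt j m = rebaseW Lc m (WbalOf 3 (Lc ^ m) cE cVH cΛ
      (T2Of 3 (Lc ^ m) cE cVH cΛ (((Lc ^ m : ℕ) : ℝ) ^ (2 * (3 + 1))) cB Tc (vh₂S 3 (Lc ^ m)) (mixFFAt (toSite r) (Lc ^ m)))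
      (mixFFAt (toSite r) (Lc ^ m))) j)
    -- an1's four COARSE LETTERS at the pinned perfect triple, for the dressed leg `Π K∞ Π` (HYPOTHESES; their suppliers = LetterInheritance instantiation)
    {M E : MKer (3 + 1) (Fib 3)} (hM : Spr M) (hE : Spr E) (hR : RelInv (axDressK Lc (KPerf (d := 3) Lc (sfStep Lc) (smStep 3 Lc) 1)) M E)
    (cH : ℝ) (hH : ∀ (y : Fin (3 + 1) → ℤ) (κ' : Fin (3 + 1)) (u : Fin (3 + 1) → ℤ),
      ∑ μ, (colH (axDressK Lc (KPerf (d := 3) Lc (sfStep Lc) (smStep 3 Lc) 1)) Lc μ (y - unitVec μ) κ' u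
        - colH (axDressK Lc (KPerf (d := 3) Lc (sfStep Lc) (smStep 3 Lc) 1)) Lc μ y κ' u) = cH * gaugeWt Lc y κ' u)
    (X : (Fin (3 + 1) → ℤ) → MKer (3 + 1) (Fib 3)) (hX : ∀ y, Loc (X y)) (hEX : ∀ y, comp E (X y) = comp (X y) E)
    (X₂ Nr : (Fin (3 + 1) → ℤ) → Fin (3 + 1) → (Fin (3 + 1) → ℤ) → MKer (3 + 1) (Fib 3)) (hX₂ : ∀ y ν y', Loc (X₂ y ν y'))
    (hNr : ∀ y ν y', Loc (Nr y ν y')) (hEX₂ : ∀ y ν y', comp E (X₂ y ν y') = comp (X₂ y ν y') E)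
    (hSd : ∀ y : Fin (3 + 1) → ℤ, cH • ∑ v ∈ box (3 + 1) Lc, divV (SPerfOf (sfStep Lc) (smStep 3 Lc) S 1) ((Lc : ℤ) • y + toSite v) = conjV M (X y))
    (hWd : ∀ (y : Fin (3 + 1) → ℤ) (ν : Fin (3 + 1)) (y' : Fin (3 + 1) → ℤ),
      divW (WPerfOf (sfStep Lc) (smStep 3 Lc) Wt 1) y ν y'
        = conjW M 0 (axVertexOfK (KPerf (d := 3) Lc (sfStep Lc) (smStep 3 Lc) 1) Lc (SPerfOf (sfStep Lc) (smStep 3 Lc) S 1) ν y') (X y) 0 (X₂ y ν y') + Nr y ν y')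
    (hN0 : ∀ y ν y', tadpole (axDressK Lc (KPerf (d := 3) Lc (sfStep Lc) (smStep 3 Lc) 1)) (Nr y ν y') = 0)
    (μ ν : Fin 4)
    (hSDF : ∀ m : ℕ, 1 ≤ m → secondMoment (defect
      (fun m => TPerfOf (Lc ^ m) (KPerf (d := 3) Lc (sfStep Lc) (smStep 3 Lc) m) (SPerfOf (sfStep Lc) (smStep 3 Lc) S m)
        (WPerfOf (sfStep Lc) (smStep 3 Lc) Wt m))
      (fun m a b z => ((Lc ^ m : ℕ) : ℝ) ^ 8 * dressedEntry (colOf (KPerf (d := 3) Lc (sfStep Lc) (smStep 3 Lc) m))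
        (TPerfOf Lc (KPerf Lc (sfStep Lc) (smStep 3 Lc) 1) (SPerfOf (sfStep Lc) (smStep 3 Lc) S 1) (WPerfOf (sfStep Lc) (smStep 3 Lc) Wt 1))
        (((Lc ^ m : ℕ) : ℤ) • z) a b) m) μ ν = 0)
    {N Cg : ℝ} (hasym : ∀ m : ℕ, 1 ≤ m → |fPerf Lc (sfStep Lc) (smStep 3 Lc) S Wt μ ν m - (m : ℝ) * stepBal N Lc| ≤ Cg)
    {β : HBeta} {Cn : B12.Construction} (hgen : ForwardGenerated Cn β) (Sβ : B12Beta.OneLoopSplit β)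
    (hβ : ∀ j, Sβ.β0 j = B12Beta.secondMoment (TbalOf Lc (JsBalT2Of (one_le_of_two_le hLc2) cE cVH cΛ ((Lc : ℝ) ^ (2 * (3 + 1))) cB Tc
      (hB_base (one_le_of_two_le hLc2)) (hmix_an1 (one_le_of_two_le hLc2) hr)) j) μ ν)
    {rr γ₀ : ℝ} (hγ₀ : 0 < γ₀) (hrem : RemainderConst Sβ γ₀ rr) (hr' : rr ≤ stepBal N Lc) (hcont : BetaContH γ₀ β) :
    EndpointExistence Cn := by
  obtain ⟨Cs, cS, θS, δS, hθS0, hθS1, hδS, hS, hSall⟩ := hS_hSall_three hLc2 cE cVH cΛ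
    (WbalOf 3 Lc cE cVH cΛ (T2Of 3 Lc cE cVH cΛ ((Lc : ℝ) ^ (2 * (3 + 1))) cB Tc (vh₂S 3 Lc) (mixFFAt (toSite r) Lc)) (mixFFAt (toSite r) Lc)) _ _
    (δwOf_pos (one_le_of_two_le hLc2) cE cVH cΛ (T2Of_loc (one_le_of_two_le hLc2) cE cVH cΛ ((Lc : ℝ) ^ (2 * (3 + 1))) cB Tc
        (hB_base (one_le_of_two_le hLc2)) (hmix_an1 (one_le_of_two_le hLc2) hr)) (hmix_an1 (one_le_of_two_le hLc2) hr))
    (WbalOf_loc₂ (one_le_of_two_le hLc2) cE cVH cΛ (T2Of_loc (one_le_of_two_le hLc2) cE cVH cΛ ((Lc : ℝ) ^ (2 * (3 + 1))) cB Tc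
        (hB_base (one_le_of_two_le hLc2)) (hmix_an1 (one_le_of_two_le hLc2) hr)) (hmix_an1 (one_le_of_two_le hLc2) hr))
  obtain ⟨Cw, cW, θW, δW, hθW0, hθW1, hδW, hW, hWall⟩ := hW_hWall_three_an1_pinned hLc2 hr cE cVH cΛ cB Tc
  exact endpointExistence_of_rows_wardPerf_bounded (one_le_of_two_le hLc2) cE cVH cΛ _ _ _ _ _ S Wt hLc2 hS1 hW1 hS hSall hW hWall hδS hδW hθS0 hθS1
    hθW0 hθW1
    (hWperf_pinned_of_letters hr cE cVH cΛ cB Tc S Wt hLc2 hS1 hW1 hM hE hR cH hH X hX hEX X₂ Nr hX₂ hNr hEX₂ hSd hWd hN0) (hTsymm_pinned hr cE cVH cΛ cB Tc S Wt hLc2 hS1 hW1) (hSinf_of_rebase cE cVH cΛ S hLc2 hSm)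
    (hWinf_of_rebase hr cE cVH cΛ cB Tc Wt hLc2 hWm) (absMoment₂_explicitDefect hr cE cVH cΛ cB Tc S Wt hLc2 hS1 hW1 hSm hWm)
    (fun m _ a b z => fubini_defect
      (TP := fun m => TPerfOf (Lc ^ m) (KPerf (d := 3) Lc (sfStep Lc) (smStep 3 Lc) m) (SPerfOf (sfStep Lc) (smStep 3 Lc) S m)
        (WPerfOf (sfStep Lc) (smStep 3 Lc) Wt m))
      (RP := fun m a b z => ((Lc ^ m : ℕ) : ℝ) ^ 8 * dressedEntry (colOf (KPerf (d := 3) Lc (sfStep Lc) (smStep 3 Lc) m))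
        (TPerfOf Lc (KPerf Lc (sfStep Lc) (smStep 3 Lc) 1) (SPerfOf (sfStep Lc) (smStep 3 Lc) S 1) (WPerfOf (sfStep Lc) (smStep 3 Lc) Wt 1))
        (((Lc ^ m : ℕ) : ℤ) • z) a b) m a b z)
    μ ν hSDF hasym hgen Sβ hβ hγ₀ hrem hr' hcont

end

end Summit.QuantumFields.BalabanUV.Beta.FP.RoadWardLetters
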